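import Literature.Analysis.FluidPDE.PassiveScalarWellPosednessProofs
import Literature.Analysis.FluidPDE.PassiveScalarEnergyProofs
import Literature.Analysis.FluidPDE.PassiveScalarSpectralBounds
import Literature.Analysis.FluidPDE.PassiveScalarFourier
import Literature.Analysis.FluidPDE.PassiveScalarClassicalEnergy
import Literature.Analysis.FluidPDE.TransportGalerkinExistence
import Literature.Analysis.FunctionSpaces.TorusMaximalLipschitz
import HarnessLib

/-!
# From classical to weak solutions: stability of dissipation lower bounds in the datum

Analysis/FluidPDE proof-support file for the discharge of
`Literature.Analysis.FluidPDE.deij_anomalous_dissipation` (`TurbPassiveScalar`); everything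
here is proved.

The target fact quantifies over *all* weak solutions (`Torus.IsWeakScalarTransportOn`, class
`L^∞_t L²_x`) with an `H²` datum `θ₀`, while the construction of Drivas–Elgindi–Iyer–Jeong is
carried out for classical solutions. This file provides the bridge, in the spirit of the
perturbation step of DEIJ, §3.3 (the datum is split into a part that is handled explicitly and
an `L²`-small remainder, and linearity plus the energy inequality control the remainder):

* `Torus.IsWeakScalarTransportOn.sub` — linearity of the weak class for integrable data;
* `Torus.rpow_half_eScalarGradNormSq_add_le` — the spectral gradient seminorm
  `θ ↦ (eScalarGradNormSq θ)^{1/2} = ‖∇θ‖_{L²}` is subadditive on integrable functions;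
* `Torus.IsClassicalScalarTransportOn.eScalarDissipation_eq_ofReal'` — for classical solutions
  the spectral dissipation is the classical one;
* **`Torus.IsWeakScalarTransportOn.rpow_half_two_mul_eScalarDissipation_classical_le`** — if
  `θ` is any weak solution on `[0,T)` with datum `θ₀ ∈ L²` and `Θ` is the classical solution on
  `[0,T'] ⊆ [0,T)` (same `κ > 0`, same jointly smooth drift on `[0,T']`) with smooth datum `Θ₀`,
  then `(2κ∫₀^{T'}‖∇Θ‖²)^{1/2} ≤ (2κ∫₀ᵀ‖∇θ‖²)^{1/2} + ‖Θ₀ - θ₀‖_{L²}`: the difference `Θ - θ`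
  is a weak solution with datum `Θ₀ - θ₀` (restriction of the horizon, cf.
  `Torus.IsWeakScalarTransportOn.of_le` of `DEIJCriterion`, and linearity), whose dissipation is
  at most `½‖Θ₀ - θ₀‖²_{L²}` by the energy inequality (`energy_ineq_holds`, DEIJ (1.2)–(1.3)),
  and `‖∇·‖_{L²_{t,x}}` is a seminorm (Minkowski);
* `Torus.IsWeakScalarTransportOn.ofReal_le_two_mul_eScalarDissipation_of_classical` — the
  numerical corollary: `4c ≤ 2κ∫₀^{T'}‖∇Θ‖²` and `‖Θ₀ - θ₀‖²_{L²} ≤ c` give `c ≤ 2κ∫₀ᵀ‖∇θ‖²`.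

## References

* T. D. Drivas, T. M. Elgindi, G. Iyer, I.-J. Jeong, *Anomalous dissipation in passive scalar
  transport*, Arch. Ration. Mech. Anal. 243 (2022), (1.2)–(1.3) and §3.3. [DrivasEtAl2022]
* R. J. DiPerna, P.-L. Lions, Invent. Math. 98 (1989), §II.1 (linearity of the weak class).
-/

open MeasureTheory Set Filter UnitAddTorus
open _root_.Topology
open scoped InnerProductSpace ContDiff ENNReal NNReal

noncomputable section

namespace Literature.Analysis.FluidPDE

namespace Torus

variable {d : Type*} [Fintype d]

/-! ## The spectral gradient seminorm is subadditive -/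

/-- **Triangle inequality for `‖∇·‖_{L²}` (spectral form)**: for integrable real `f, g` on
`T^d`, `(eScalarGradNormSq (f + g))^{1/2} ≤ (eScalarGradNormSq f)^{1/2} + (eScalarGradNormSq g)^{1/2}`
(Minkowski in the weighted `ℓ²(ℤ^d)` with weights `4π²|k|²`, after `𝓕(f+g) = 𝓕f + 𝓕g`, which
needs integrability). [folklore] -/
theorem rpow_half_eScalarGradNormSq_add_le {f g : UnitAddTorus d → ℝ} (hf : Integrable f volume)
    (hg : Integrable g volume) :
    eScalarGradNormSq (fun x => f x + g x) ^ (1 / 2 : ℝ) ≤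
      eScalarGradNormSq f ^ (1 / 2 : ℝ) + eScalarGradNormSq g ^ (1 / 2 : ℝ) := by
  letI : MeasurableSpace (d → ℤ) := ⊤
  haveI : MeasurableSingletonClass (d → ℤ) := ⟨fun _ => trivial⟩
  set c : (d → ℤ) → ℝ≥0∞ := fun k =>
    ENNReal.ofReal (4 * Real.pi ^ 2 * FunctionSpaces.Torus.freqNormSq k) ^ (1 / 2 : ℝ) with hc
  have hrepr : ∀ θ : UnitAddTorus d → ℝ, eScalarGradNormSq θ ^ (1 / 2 : ℝ) =
      (∫⁻ k, (fun k => c k * ‖mFourierCoeff (fun x => (θ x : ℂ)) k‖ₑ) k ^ (2 : ℝ) ∂Measure.count) ^ (1 / (2 : ℝ)) := by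
    intro θ
    rw [eScalarGradNormSq_eq_tsum', lintegral_count]
    congr 1
    exact tsum_congr fun k => (ENNReal.rpow_two _).symm
  have hfC : Integrable (fun x => (f x : ℂ)) volume := hf.ofReal
  have hgC : Integrable (fun x => (g x : ℂ)) volume := hg.ofReal
  have hadd : ∀ k, mFourierCoeff (fun x => ((f x + g x : ℝ) : ℂ)) k =
      mFourierCoeff (fun x => (f x : ℂ)) k + mFourierCoeff (fun x => (g x : ℂ)) k := by
    intro k
    have e : (fun x => ((f x + g x : ℝ) : ℂ)) = (fun x => (f x : ℂ)) + fun x => (g x : ℂ) := by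
      funext x
      simp
    rw [e, FunctionSpaces.Torus.mFourierCoeff_add hfC hgC]
  rw [hrepr, hrepr f, hrepr g]
  calc (∫⁻ k, (c k * ‖mFourierCoeff (fun x => ((f x + g x : ℝ) : ℂ)) k‖ₑ) ^ (2 : ℝ) ∂Measure.count) ^ (1 / (2 : ℝ))
      ≤ (∫⁻ k, ((fun k => c k * ‖mFourierCoeff (fun x => (f x : ℂ)) k‖ₑ) +
            (fun k => c k * ‖mFourierCoeff (fun x => (g x : ℂ)) k‖ₑ)) k ^ (2 : ℝ) ∂Measure.count) ^ (1 / (2 : ℝ)) := by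
        gcongr with k
        rw [Pi.add_apply, ← mul_add, hadd k]
        gcongr
        exact enorm_add_le _ _
    _ ≤ _ := ENNReal.lintegral_Lp_add_le (Measurable.of_discrete.aemeasurable)
          (Measurable.of_discrete.aemeasurable) (by norm_num)

/-! ## Restriction and linearity of the weak class -/

namespace IsWeakScalarTransportOn

variable {T T' κ : ℝ} {u : ℝ → UnitAddTorus d → EuclideanSpace ℝ d} {θ₀ ϑ₀ : UnitAddTorus d → ℝ}
  {θ ϑ : ℝ → UnitAddTorus d → ℝ}

/-- Restriction of the horizon of a weak solution (`T' ≤ T`); a private copy of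
`Torus.IsWeakScalarTransportOn.of_le` (`DEIJCriterion`), kept local so that this file does not
depend on that module. [folklore] -/
private theorem of_le_aux (h : IsWeakScalarTransportOn T κ u θ₀ θ) (hT' : T' ≤ T) :
    IsWeakScalarTransportOn T' κ u θ₀ θ := by
  have hsub : Ioo (0 : ℝ) T' ⊆ Ioo 0 T := Ioo_subset_Ioo le_rfl hT'
  have hμ : volume.restrict (Ioo (0 : ℝ) T') ≤ volume.restrict (Ioo 0 T) := Measure.restrict_mono hsub le_rfl
  have hμ2 : volume.restrict (Ioo (0 : ℝ) T' ×ˢ (univ : Set (EuclideanSpace ℝ d))) ≤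
      volume.restrict (Ioo 0 T ×ˢ (univ : Set (EuclideanSpace ℝ d))) :=
    Measure.restrict_mono (prod_mono hsub subset_rfl) le_rfl
  obtain ⟨C, hC⟩ := h.ae_lintegral_sq_le
  refine ⟨h.aestronglyMeasurable.mono_measure hμ2, h.aestronglyMeasurable_velocity.mono_measure hμ2, ⟨C, ?_⟩,
    lt_of_le_of_lt (lintegral_mono_set hsub) h.lintegral_velocity_lt_top,
    lt_of_le_of_lt (lintegral_mono_set hsub) h.lintegral_mul_lt_top, ?_, fun ψ hψ => ?_⟩
  · exact ae_mono hμ hC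
  · exact ae_mono hμ h.ae_isWeaklyDivFree
  · obtain ⟨hs, T'', hT'', h0⟩ := hψ
    have hw := h.weak_eq ψ ⟨hs, T'', hT''.trans_le hT', h0⟩
    rw [setIntegral_eq_of_subset_of_forall_sdiff_eq_zero measurableSet_Ioo hsub] at hw
    · exact hw
    · intro t ht
      have htT'' : T'' < t := hT''.trans_le (not_lt.1 fun h' => ht.2 ⟨ht.1.1, h'⟩)
      have hz : ψ t = 0 := h0 t htT''.le
      have hdt : ∀ x, FunctionSpaces.Torus.timeDeriv ψ t x = 0 := by
        intro x
        have hev : (fun τ => ψ τ x) =ᶠ[𝓝 t] fun _ => (0 : ℝ) := by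
          filter_upwards [Ioi_mem_nhds htT''] with τ hτ
          rw [h0 τ (le_of_lt hτ), Pi.zero_apply]
        change deriv (fun τ => ψ τ x) t = 0
        rw [hev.deriv_eq, deriv_const]
      refine integral_eq_zero_of_ae (Eventually.of_forall fun x => ?_)
      have hg : FunctionSpaces.Torus.gradient (ψ t) x = 0 := by
        rw [hz]
        exact gradient_fun_const _ _
      have hl : FunctionSpaces.Torus.laplacian (ψ t) x = 0 := by
        rw [hz]
        change Laplacian.laplacian (fun _ : EuclideanSpace ℝ d => (0 : ℝ)) 0 = 0
        rw [InnerProductSpace.laplacian_const]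
        rfl
      simp [hdt x, hg, hl]

/-- **Linearity of the weak class** (general data): the difference of two weak solutions with
the same drift and diffusivity and integrable data `θ₀`, `ϑ₀` is a weak solution with datum
`θ₀ - ϑ₀` (DiPerna–Lions 1989, §II.1; the integrability of the data is what makes the pairings
`∫ θ₀ ψ(0)`, `∫ ϑ₀ ψ(0)` genuine integrals). [folklore] -/
theorem sub (h₁ : IsWeakScalarTransportOn T κ u θ₀ θ) (h₂ : IsWeakScalarTransportOn T κ u ϑ₀ ϑ)
    (hθ₀ : Integrable θ₀ volume) (hϑ₀ : Integrable ϑ₀ volume) :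
    IsWeakScalarTransportOn T κ u (fun x => θ₀ x - ϑ₀ x) (fun t x => θ t x - ϑ t x) := by
  obtain ⟨C₁, hC₁⟩ := h₁.ae_lintegral_sq_le
  obtain ⟨C₂, hC₂⟩ := h₂.ae_lintegral_sq_le
  refine ⟨h₁.aestronglyMeasurable.sub h₂.aestronglyMeasurable, h₁.aestronglyMeasurable_velocity,
    ⟨2 * C₁ + 2 * C₂, ?_⟩, h₁.lintegral_velocity_lt_top, ?_, h₁.ae_isWeaklyDivFree, fun ψ hψ => ?_⟩
  · -- `L^∞ₜ L²ₓ`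
    filter_upwards [hC₁, hC₂, h₁.ae_aestronglyMeasurable_slice] with t ht₁ ht₂ hm₁
    calc ∫⁻ x, ‖θ t x - ϑ t x‖ₑ ^ 2 ≤ ∫⁻ x, (2 * ‖θ t x‖ₑ ^ 2 + 2 * ‖ϑ t x‖ₑ ^ 2) := by
          refine lintegral_mono fun x => (le_trans ?_ (FunctionSpaces.Torus.ennreal_add_sq_le _ _))
          gcongr
          exact enorm_sub_le
      _ = (∫⁻ x, 2 * ‖θ t x‖ₑ ^ 2) + ∫⁻ x, 2 * ‖ϑ t x‖ₑ ^ 2 :=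
          lintegral_add_left' ((hm₁.enorm.pow_const 2).const_mul _) _
      _ ≤ 2 * C₁ + 2 * C₂ := by
          rw [lintegral_const_mul' _ _ ENNReal.ofNat_ne_top, lintegral_const_mul' _ _ ENNReal.ofNat_ne_top]
          gcongr
  · -- `u (θ - ϑ) ∈ L¹`
    set μ : Measure (ℝ × UnitAddTorus d) := ((volume : Measure ℝ).restrict (Ioo 0 T)).prod volume with hμ
    have hmu := h₁.aestronglyMeasurable_uncurry_velocity
    have hF₁ : AEMeasurable (fun p : ℝ × UnitAddTorus d => ‖u p.1 p.2‖ₑ * ‖θ p.1 p.2‖ₑ) μ :=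
      hmu.enorm.mul h₁.aestronglyMeasurable_uncurry.enorm
    have hF₂ : AEMeasurable (fun p : ℝ × UnitAddTorus d => ‖u p.1 p.2‖ₑ * ‖ϑ p.1 p.2‖ₑ) μ :=
      hmu.enorm.mul h₂.aestronglyMeasurable_uncurry.enorm
    have hF : AEMeasurable (fun p : ℝ × UnitAddTorus d => ‖u p.1 p.2‖ₑ * ‖θ p.1 p.2 - ϑ p.1 p.2‖ₑ) μ :=
      hmu.enorm.mul (h₁.aestronglyMeasurable_uncurry.sub h₂.aestronglyMeasurable_uncurry).enorm
    have e : ∀ {F : ℝ × UnitAddTorus d → ℝ≥0∞}, AEMeasurable F μ →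
        ∫⁻ t in Ioo 0 T, ∫⁻ x, F (t, x) = ∫⁻ p, F p ∂μ := fun hF => (lintegral_prod _ hF).symm
    rw [e hF]
    have h1 : ∫⁻ p, ‖u p.1 p.2‖ₑ * ‖θ p.1 p.2‖ₑ ∂μ < ⊤ := by rw [← e hF₁]; exact h₁.lintegral_mul_lt_top
    have h2 : ∫⁻ p, ‖u p.1 p.2‖ₑ * ‖ϑ p.1 p.2‖ₑ ∂μ < ⊤ := by rw [← e hF₂]; exact h₂.lintegral_mul_lt_top
    calc ∫⁻ p, ‖u p.1 p.2‖ₑ * ‖θ p.1 p.2 - ϑ p.1 p.2‖ₑ ∂μ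
        ≤ ∫⁻ p, (‖u p.1 p.2‖ₑ * ‖θ p.1 p.2‖ₑ + ‖u p.1 p.2‖ₑ * ‖ϑ p.1 p.2‖ₑ) ∂μ := by
          refine lintegral_mono fun p => ?_
          rw [← mul_add]
          gcongr
          exact enorm_sub_le
      _ = (∫⁻ p, ‖u p.1 p.2‖ₑ * ‖θ p.1 p.2‖ₑ ∂μ) + ∫⁻ p, ‖u p.1 p.2‖ₑ * ‖ϑ p.1 p.2‖ₑ ∂μ :=
          lintegral_add_left' hF₁ _
      _ < ⊤ := ENNReal.add_lt_top.2 ⟨h1, h2⟩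
  · -- the weak formulation
    have e₁ := h₁.integral_prod_weak_eq hψ
    have e₂ := h₂.integral_prod_weak_eq hψ
    have hint : Integrable (fun p : ℝ × UnitAddTorus d => (θ p.1 p.2 - ϑ p.1 p.2) *
        (FunctionSpaces.Torus.timeDeriv ψ p.1 p.2 + ⟪u p.1 p.2, FunctionSpaces.Torus.gradient (ψ p.1) p.2⟫_ℝ +
          κ * FunctionSpaces.Torus.laplacian (ψ p.1) p.2))
        (((volume : Measure ℝ).restrict (Ioo 0 T)).prod volume) := by
      have h := (h₁.integrable_weakIntegrand hψ).sub (h₂.integrable_weakIntegrand hψ)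
      refine h.congr (Eventually.of_forall fun p => ?_)
      simp only [Pi.sub_apply]
      ring
    rw [← integral_prod _ hint]
    have hsplit : ∫ p : ℝ × UnitAddTorus d, (θ p.1 p.2 - ϑ p.1 p.2) *
        (FunctionSpaces.Torus.timeDeriv ψ p.1 p.2 + ⟪u p.1 p.2, FunctionSpaces.Torus.gradient (ψ p.1) p.2⟫_ℝ +
          κ * FunctionSpaces.Torus.laplacian (ψ p.1) p.2) ∂(((volume : Measure ℝ).restrict (Ioo 0 T)).prod volume) =
        (∫ p : ℝ × UnitAddTorus d, θ p.1 p.2 *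
          (FunctionSpaces.Torus.timeDeriv ψ p.1 p.2 + ⟪u p.1 p.2, FunctionSpaces.Torus.gradient (ψ p.1) p.2⟫_ℝ +
            κ * FunctionSpaces.Torus.laplacian (ψ p.1) p.2) ∂(((volume : Measure ℝ).restrict (Ioo 0 T)).prod volume)) -
        ∫ p : ℝ × UnitAddTorus d, ϑ p.1 p.2 *
          (FunctionSpaces.Torus.timeDeriv ψ p.1 p.2 + ⟪u p.1 p.2, FunctionSpaces.Torus.gradient (ψ p.1) p.2⟫_ℝ +
            κ * FunctionSpaces.Torus.laplacian (ψ p.1) p.2) ∂(((volume : Measure ℝ).restrict (Ioo 0 T)).prod volume) := by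
      rw [← integral_sub (h₁.integrable_weakIntegrand hψ) (h₂.integrable_weakIntegrand hψ)]
      refine integral_congr_ae (Eventually.of_forall fun p => ?_)
      ring
    -- the datum pairings are genuine integrals
    have hψ0 : Continuous (ψ 0) := (hψ.isSmooth_slice 0).continuous
    obtain ⟨C, hC⟩ := FunctionSpaces.Torus.exists_forall_norm_le_of_continuous hψ0
    have hi₁ : Integrable (fun x => θ₀ x * ψ 0 x) volume :=
      hθ₀.mul_of_top_left (memLp_top_of_bound hψ0.aestronglyMeasurable C (Eventually.of_forall hC))
    have hi₂ : Integrable (fun x => ϑ₀ x * ψ 0 x) volume :=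
      hϑ₀.mul_of_top_left (memLp_top_of_bound hψ0.aestronglyMeasurable C (Eventually.of_forall hC))
    have hdat : ∫ x, (θ₀ x - ϑ₀ x) * ψ 0 x = (∫ x, θ₀ x * ψ 0 x) - ∫ x, ϑ₀ x * ψ 0 x := by
      rw [← integral_sub hi₁ hi₂]
      refine integral_congr_ae (Eventually.of_forall fun x => ?_)
      ring
    rw [hsplit, hdat]
    linarith

/-- Every weak solution has integrable slices `θ t ∈ L¹(T^d)` for a.e. `t ∈ (0,T)`. [folklore] -/
theorem ae_integrable_slice' (h : IsWeakScalarTransportOn T κ u θ₀ θ) :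
    ∀ᵐ t ∂(volume.restrict (Ioo 0 T)), Integrable (θ t) volume := by
  filter_upwards [h.ae_integrable_slice] with t ht
  exact ht.1

end IsWeakScalarTransportOn

/-! ## The dissipation functional of a classical solution -/

namespace IsClassicalScalarTransportOn

variable [DecidableEq d] {κ T : ℝ} {u : ℝ → UnitAddTorus d → EuclideanSpace ℝ d} {θ : ℝ → UnitAddTorus d → ℝ}

/-- For a classical solution on `[0,T]` (`T > 0`, `κ ≥ 0`) the spectral dissipation
`eScalarDissipation κ θ 0 T` is `ofReal` of the classical one `κ ∫₀ᵀ ∫ ‖∇θ‖²`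
(`scalarDissipation`): the slices are smooth, so the spectral and derivative-based gradient
norms agree (`eScalarGradNormSq_eq_ofReal_integral`), and `t ↦ ‖∇θ(t)‖²` is continuous.
(Same statement as `Torus.eScalarDissipation_eq_ofReal` of `ReleaseLogBoundSmooth`, reproved to
keep the import chain of this file short.) [folklore] -/
theorem eScalarDissipation_eq_ofReal' (hκ : 0 ≤ κ) (hT : 0 < T)
    (hθ : IsClassicalScalarTransportOn (Icc 0 T) κ u θ) :
    eScalarDissipation κ θ 0 T = ENNReal.ofReal (scalarDissipation κ θ 0 T) := by
  have hGc : ContinuousOn (fun t => scalarGradNormSq (θ t)) (Icc 0 T) :=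
    hθ.continuousOn_scalarGradNormSq (convex_Icc 0 T) (uniqueDiffOn_Icc hT)
  have hGi : IntegrableOn (fun t => scalarGradNormSq (θ t)) (Ioo 0 T) :=
    hGc.integrableOn_Icc.mono_set Ioo_subset_Icc_self
  have h1 : ∫⁻ t in Ioo 0 T, eScalarGradNormSq (θ t) = ENNReal.ofReal (∫ t in Ioo 0 T, scalarGradNormSq (θ t)) := by
    rw [ofReal_integral_eq_lintegral_ofReal hGi (Eventually.of_forall fun t => scalarGradNormSq_nonneg _)]
    refine setLIntegral_congr_fun measurableSet_Ioo fun t ht => ?_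
    exact eScalarGradNormSq_eq_ofReal_integral (hθ.smooth_scalar.isSmooth_slice (Ioo_subset_Icc_self ht))
  rw [eScalarDissipation, h1, ← ENNReal.ofReal_mul hκ, scalarDissipation, intervalIntegral.integral_of_le hT.le,
    integral_Ioc_eq_integral_Ioo]

end IsClassicalScalarTransportOn

/-! ## Dissipation lower bounds pass from classical to weak solutions -/

namespace IsWeakScalarTransportOn

variable [DecidableEq d] {T T' κ : ℝ} {u : ℝ → UnitAddTorus d → EuclideanSpace ℝ d}
  {θ₀ : UnitAddTorus d → ℝ} {θ Θ : ℝ → UnitAddTorus d → ℝ}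

omit [DecidableEq d] in
/-- `eScalarDissipation` is monotone in the horizon. [folklore] -/
theorem _root_.Literature.Analysis.FluidPDE.Torus.eScalarDissipation_mono_right (κ : ℝ) (θ : ℝ → UnitAddTorus d → ℝ)
    (hT' : T' ≤ T) : eScalarDissipation κ θ 0 T' ≤ eScalarDissipation κ θ 0 T := by
  unfold eScalarDissipation
  exact mul_le_mul_right (lintegral_mono_set (Ioo_subset_Ioo le_rfl hT')) _

/-- **Stability of dissipation in the datum (classical versus weak).** Let `0 < T' ≤ T`,
`κ > 0`, let `θ` be any weak solution on `[0,T)` with datum `θ₀ ∈ L²(T^d)`, and let `Θ` be a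
classical solution on `[0,T'] × T^d` for the same drift `u` (jointly smooth and divergence free
on `[0,T']`) and the same `κ`. Then
`(2κ∫₀^{T'}‖∇Θ‖²)^{1/2} ≤ (2κ∫₀ᵀ‖∇θ‖²)^{1/2} + ‖Θ(0) - θ₀‖_{L²}`
(spectral dissipations, `ℝ≥0∞`-valued). Proof: `Θ - θ` is a weak solution on `[0,T')` with datum
`Θ(0) - θ₀` (classical ⇒ weak, restriction, linearity), its dissipation is at most
`½‖Θ(0) - θ₀‖²_{L²}` by the energy inequality for bounded drifts (DEIJ 2022, (1.2)–(1.3);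
`energy_ineq_holds`), and `(κ∫‖∇·‖²)^{1/2}` is subadditive (Minkowski in `t` and in the
Fourier variable). This is the perturbation step of DEIJ, §3.3, in dissipation form.
[cite: DrivasEtAl2022, §3.3 and (1.2)–(1.3)] -/
theorem rpow_half_two_mul_eScalarDissipation_classical_le (hκ : 0 < κ) (hT' : 0 < T') (hT'T : T' ≤ T)
    (hθ : IsWeakScalarTransportOn T κ u θ₀ θ) (hθ₀ : MemLp θ₀ 2 volume)
    (hΘ : IsClassicalScalarTransportOn (Icc 0 T') κ u Θ) :
    (2 * eScalarDissipation κ Θ 0 T') ^ (1 / 2 : ℝ) ≤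
      (2 * eScalarDissipation κ θ 0 T) ^ (1 / 2 : ℝ) + (∫⁻ x, ‖Θ 0 x - θ₀ x‖ₑ ^ 2) ^ (1 / 2 : ℝ) := by
  -- the three weak solutions on `[0,T')`
  have hθ' : IsWeakScalarTransportOn T' κ u θ₀ θ := of_le_aux hθ hT'T
  have hΘw : IsWeakScalarTransportOn T' κ u (Θ 0) Θ :=
    IsClassicalScalarTransportOn.isWeakScalarTransportOn_holds hΘ subset_rfl
  have hΘ0 : FunctionSpaces.Torus.IsSmooth (Θ 0) := hΘ.smooth_scalar.isSmooth_slice ⟨le_rfl, hT'.le⟩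
  have hθ₀i : Integrable θ₀ volume := hθ₀.integrable one_le_two
  have hψ : IsWeakScalarTransportOn T' κ u (fun x => Θ 0 x - θ₀ x) (fun t x => Θ t x - θ t x) :=
    hΘw.sub hθ' hΘ0.integrable hθ₀i
  -- energy inequality for the difference
  have huinf := memLp_top_stLift_of_isSmoothSpaceTimeOn (T := T') hΘ.smooth_velocity
  have hdat : MemLp (fun x => Θ 0 x - θ₀ x) 2 volume := (hΘ0.memLp 2).sub hθ₀
  have hE : 2 * eScalarDissipation κ (fun t x => Θ t x - θ t x) 0 T' ≤ ∫⁻ x, ‖Θ 0 x - θ₀ x‖ₑ ^ 2 :=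
    energy_ineq_holds hκ hψ hdat huinf
  -- Minkowski in the Fourier variable, slice by slice
  set μ : Measure ℝ := volume.restrict (Ioo 0 T') with hμ
  set F : ℝ → ℝ≥0∞ := fun t => eScalarGradNormSq (θ t) ^ (1 / 2 : ℝ) with hF
  set G : ℝ → ℝ≥0∞ := fun t => eScalarGradNormSq (fun x => Θ t x - θ t x) ^ (1 / 2 : ℝ) with hG
  have hFm : AEMeasurable F μ := hθ'.aemeasurable_eScalarGradNormSq.pow_const _
  have hGm : AEMeasurable G μ := hψ.aemeasurable_eScalarGradNormSq.pow_const _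
  have hslice : ∀ᵐ t ∂μ, eScalarGradNormSq (Θ t) ≤ (F + G) t ^ (2 : ℝ) := by
    filter_upwards [hθ'.ae_integrable_slice', ae_restrict_mem measurableSet_Ioo] with t hti htI
    have hΘt : Integrable (Θ t) volume := (hΘ.smooth_scalar.isSmooth_slice (Ioo_subset_Icc_self htI)).integrable
    have hdiff : Integrable (fun x => Θ t x - θ t x) volume := hΘt.sub hti
    have hsum : (fun x => θ t x + (Θ t x - θ t x)) = Θ t := by
      funext x
      ring
    have h := rpow_half_eScalarGradNormSq_add_le hti hdiff
    rw [hsum] at h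
    calc eScalarGradNormSq (Θ t) = (eScalarGradNormSq (Θ t) ^ (1 / 2 : ℝ)) ^ (2 : ℝ) := by
          rw [← ENNReal.rpow_mul]; norm_num
      _ ≤ (F + G) t ^ (2 : ℝ) := by
          gcongr
          exact h
  have hMink : (∫⁻ t, eScalarGradNormSq (Θ t) ∂μ) ^ (1 / 2 : ℝ) ≤
      (∫⁻ t, F t ^ (2 : ℝ) ∂μ) ^ (1 / 2 : ℝ) + (∫⁻ t, G t ^ (2 : ℝ) ∂μ) ^ (1 / 2 : ℝ) := by
    calc (∫⁻ t, eScalarGradNormSq (Θ t) ∂μ) ^ (1 / 2 : ℝ) ≤ (∫⁻ t, (F + G) t ^ (2 : ℝ) ∂μ) ^ (1 / (2 : ℝ)) :=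
          ENNReal.rpow_le_rpow (lintegral_mono_ae hslice) (by norm_num)
      _ ≤ (∫⁻ t, F t ^ (2 : ℝ) ∂μ) ^ (1 / (2 : ℝ)) + (∫⁻ t, G t ^ (2 : ℝ) ∂μ) ^ (1 / (2 : ℝ)) :=
          ENNReal.lintegral_Lp_add_le hFm hGm (by norm_num)
  have hF2 : ∫⁻ t, F t ^ (2 : ℝ) ∂μ = ∫⁻ t, eScalarGradNormSq (θ t) ∂μ := by
    refine lintegral_congr fun t => ?_
    rw [hF, ← ENNReal.rpow_mul]; norm_num
  have hG2 : ∫⁻ t, G t ^ (2 : ℝ) ∂μ = ∫⁻ t, eScalarGradNormSq (fun x => Θ t x - θ t x) ∂μ := by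
    refine lintegral_congr fun t => ?_
    rw [hG, ← ENNReal.rpow_mul]; norm_num
  rw [hF2, hG2] at hMink
  -- multiply by `(2κ)^{1/2}` and compare
  have hscale : ∀ X : ℝ≥0∞, (2 * (ENNReal.ofReal κ * X)) ^ (1 / 2 : ℝ) =
      (2 * ENNReal.ofReal κ) ^ (1 / 2 : ℝ) * X ^ (1 / 2 : ℝ) := by
    intro X
    rw [← mul_assoc, ENNReal.mul_rpow_of_nonneg _ _ (by norm_num : (0 : ℝ) ≤ 1 / 2)]
  have hdissΘ : (2 * eScalarDissipation κ Θ 0 T') ^ (1 / 2 : ℝ) =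
      (2 * ENNReal.ofReal κ) ^ (1 / 2 : ℝ) * (∫⁻ t, eScalarGradNormSq (Θ t) ∂μ) ^ (1 / 2 : ℝ) := hscale _
  have hdissθ : (2 * eScalarDissipation κ θ 0 T') ^ (1 / 2 : ℝ) =
      (2 * ENNReal.ofReal κ) ^ (1 / 2 : ℝ) * (∫⁻ t, eScalarGradNormSq (θ t) ∂μ) ^ (1 / 2 : ℝ) := hscale _
  have hdissψ : (2 * eScalarDissipation κ (fun t x => Θ t x - θ t x) 0 T') ^ (1 / 2 : ℝ) =
      (2 * ENNReal.ofReal κ) ^ (1 / 2 : ℝ) * (∫⁻ t, eScalarGradNormSq (fun x => Θ t x - θ t x) ∂μ) ^ (1 / 2 : ℝ) :=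
    hscale _
  calc (2 * eScalarDissipation κ Θ 0 T') ^ (1 / 2 : ℝ)
      ≤ (2 * ENNReal.ofReal κ) ^ (1 / 2 : ℝ) * ((∫⁻ t, eScalarGradNormSq (θ t) ∂μ) ^ (1 / 2 : ℝ) +
          (∫⁻ t, eScalarGradNormSq (fun x => Θ t x - θ t x) ∂μ) ^ (1 / 2 : ℝ)) := by
        rw [hdissΘ]
        gcongr
    _ = (2 * eScalarDissipation κ θ 0 T') ^ (1 / 2 : ℝ) +
          (2 * eScalarDissipation κ (fun t x => Θ t x - θ t x) 0 T') ^ (1 / 2 : ℝ) := by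
        rw [mul_add, hdissθ, hdissψ]
    _ ≤ (2 * eScalarDissipation κ θ 0 T) ^ (1 / 2 : ℝ) + (∫⁻ x, ‖Θ 0 x - θ₀ x‖ₑ ^ 2) ^ (1 / 2 : ℝ) := by
        exact add_le_add (ENNReal.rpow_le_rpow (mul_le_mul_right (eScalarDissipation_mono_right κ θ hT'T) 2)
          (by norm_num)) (ENNReal.rpow_le_rpow hE (by norm_num))

/-- **Numerical corollary** used in the discharge of DEIJ Thm. 2: under the hypotheses of
`rpow_half_two_mul_eScalarDissipation_classical_le`, if the classical solution dissipates
`4c ≤ 2κ∫₀^{T'}‖∇Θ‖²` (classical dissipation functional) and its datum is `L²`-close to `θ₀`,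
`‖Θ(0) - θ₀‖²_{L²} ≤ c`, then every weak solution with datum `θ₀` dissipates
`c ≤ 2κ∫₀ᵀ‖∇θ‖²` (`(4c)^{1/2} - c^{1/2} = c^{1/2}`). [cite: DrivasEtAl2022, §3.3 and (1.2)–(1.3)] -/
theorem ofReal_le_two_mul_eScalarDissipation_of_classical (hκ : 0 < κ) (hT' : 0 < T') (hT'T : T' ≤ T)
    (hθ : IsWeakScalarTransportOn T κ u θ₀ θ) (hθ₀ : MemLp θ₀ 2 volume)
    (hΘ : IsClassicalScalarTransportOn (Icc 0 T') κ u Θ) {c : ℝ} (hc : 0 ≤ c)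
    (hdiss : 4 * c ≤ 2 * scalarDissipation κ Θ 0 T') (hclose : ∫ x, (Θ 0 x - θ₀ x) ^ 2 ≤ c) :
    ENNReal.ofReal c ≤ 2 * eScalarDissipation κ θ 0 T := by
  have hmain := rpow_half_two_mul_eScalarDissipation_classical_le hκ hT' hT'T hθ hθ₀ hΘ
  have hΘ0 : FunctionSpaces.Torus.IsSmooth (Θ 0) := hΘ.smooth_scalar.isSmooth_slice ⟨le_rfl, hT'.le⟩
  have hdat : MemLp (fun x => Θ 0 x - θ₀ x) 2 volume := (hΘ0.memLp 2).sub hθ₀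
  -- the classical dissipation in `ℝ≥0∞`
  have hΘe : ENNReal.ofReal (4 * c) ≤ 2 * eScalarDissipation κ Θ 0 T' := by
    rw [hΘ.eScalarDissipation_eq_ofReal' hκ.le hT', ← ENNReal.ofReal_ofNat 2,
      ← ENNReal.ofReal_mul (by norm_num : (0 : ℝ) ≤ 2)]
    exact ENNReal.ofReal_le_ofReal hdiss
  -- the datum distance in `ℝ≥0∞`
  have hclose' : (∫⁻ x, ‖Θ 0 x - θ₀ x‖ₑ ^ 2) ≤ ENNReal.ofReal c := by
    rw [lintegral_enorm_sq_eq_ofReal_sq hdat]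
    exact ENNReal.ofReal_le_ofReal hclose
  -- square roots
  have hsq4 : ENNReal.ofReal (4 * c) ^ (1 / 2 : ℝ) = ENNReal.ofReal (2 * Real.sqrt c) := by
    rw [ENNReal.ofReal_rpow_of_nonneg (by positivity) (by norm_num), ← Real.sqrt_eq_rpow,
      show (4 : ℝ) * c = 2 ^ 2 * c by norm_num, Real.sqrt_mul' _ hc, Real.sqrt_sq (by norm_num : (0 : ℝ) ≤ 2)]
  have hsqc : ENNReal.ofReal c ^ (1 / 2 : ℝ) = ENNReal.ofReal (Real.sqrt c) := by
    rw [ENNReal.ofReal_rpow_of_nonneg hc (by norm_num), ← Real.sqrt_eq_rpow]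
  set X : ℝ≥0∞ := (2 * eScalarDissipation κ θ 0 T) ^ (1 / 2 : ℝ) with hX
  have h1 : ENNReal.ofReal (2 * Real.sqrt c) ≤ X + ENNReal.ofReal (Real.sqrt c) := by
    calc ENNReal.ofReal (2 * Real.sqrt c) = ENNReal.ofReal (4 * c) ^ (1 / 2 : ℝ) := hsq4.symm
      _ ≤ (2 * eScalarDissipation κ Θ 0 T') ^ (1 / 2 : ℝ) := by gcongr
      _ ≤ X + (∫⁻ x, ‖Θ 0 x - θ₀ x‖ₑ ^ 2) ^ (1 / 2 : ℝ) := hmain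
      _ ≤ X + ENNReal.ofReal c ^ (1 / 2 : ℝ) := by gcongr
      _ = X + ENNReal.ofReal (Real.sqrt c) := by rw [hsqc]
  have h2 : ENNReal.ofReal (Real.sqrt c) ≤ X := by
    have e : ENNReal.ofReal (2 * Real.sqrt c) = ENNReal.ofReal (Real.sqrt c) + ENNReal.ofReal (Real.sqrt c) := by
      rw [← ENNReal.ofReal_add (Real.sqrt_nonneg c) (Real.sqrt_nonneg c)]; ring_nf
    rw [e] at h1
    exact ENNReal.le_of_add_le_add_right ENNReal.ofReal_ne_top h1
  calc ENNReal.ofReal c = ENNReal.ofReal (Real.sqrt c) ^ 2 := by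
        rw [← ENNReal.ofReal_pow (Real.sqrt_nonneg c), Real.sq_sqrt hc]
    _ ≤ X ^ 2 := by gcongr
    _ = 2 * eScalarDissipation κ θ 0 T := by rw [hX, ENNReal.rpow_half_sq]

end IsWeakScalarTransportOn

end Torus

end Literature.Analysis.FluidPDE
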